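/-
Copyright (c) 2026 the pub-hodgecm-mathlib formalisation cell (harness21).  Prover seat hodgecm-mathlib-K2Liu-p12 (g0): Track B «K2-LIT»,
#184♮ = hLiu418 = stmt-HodgeConjecture-24832; Road Φ of socket #41, organ Φ5 «bad finite places» (LEAD F0P6-plan (g12) CAP-1 deal, REQUESTS l.72710), file F3a.
-/
import Summits.HodgeConjecture.HodgeConjecture.Theorems.K2LiuUnipDeltaConjugationModulus   -- ★ `exists_homeomorph_skew`, Levi∕Weyl algebra, `continuous_matS`
import Summits.HodgeConjecture.HodgeConjecture.Theorems.K2LiuSiegelDoubledLeviMatrix       -- ★ ring-level `cstar_levi`, `leviD_mul`, `leviD_one`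
import Literature.NumberTheory.Automorphic.QuadraticLocalBaseChange                      -- ★ `toLocalRing`, `conjLocal_toLocalRing` (`F_v`-structure of `E ⊗ F_v`)
import Literature.NumberTheory.Automorphic.AdicCompletionLocalField                      -- ★ `F_v` is a non-archimedean local field
import Literature.NumberTheory.Automorphic.TateLocalZetaShells                           -- ★ `primePowBall`, `exists_primePowBall_subset_of_mem_nhds_zero`
import Mathlib.Analysis.Normed.Ring.Units
import Mathlib.Topology.Instances.Matrix
import HarnessLib

/-!
# Crux `HLiu418`, Road Φ of socket #41, organ Φ5 — FILE F3a: SUPPLY OF LEVI ELEMENTS `m(1 + z u)` IN ANY OPEN SUBGROUP OF `H(F_v)`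

Cell `hodgecm-mathlib`, crux item hLiu418 = `stmt-HodgeConjecture-24832`, route of record `HCCMUnconditional`; squad K2 ∕ K2Liu, road `K2_Liu`,
socket #41 `sig_K2LiuSiegelEisensteinContinuation`, Road Φ (ruling «M-155l»), organ Φ5 (census `K2/K2Liu-p12/g0/CENSUS-PHI5-…md`, spec
`K2/K2Liu-p12/g0/SPEC-PHI5-F3-LeviSupplyAndCovering.K2Liu-p12-g0.md` §F3a).  THEOREMS ONLY (no `def`, no `instance`, no `notation`, no named-fact hypothesis,
no `sorry`); lane `--supports stmt-HodgeConjecture-24832` (count-neutral helper; closes no socket by itself).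

This file discharges, β-independently, the LEVI-SUPPLY hypotheses (`hqU hqC hqB hqχ hqabs hL`) of ★ F4a
`K2LiuBadPlaceWhittakerShells.setIntegral_shell_eq_zero_of_levi`.  Carriers: ★ D10 ∕ ★ GR91 local frame `H(F_v) = UnitaryGroup.localPi E c (n + n) J^𝔻 v`,
`R = E ⊗ F_v = LocalRing E v`, `σ = conjLocal`, `T = gramS`, `ẑ = toLocalRing E v z` (`z ∈ F_v`, ★ `QuadraticLocalBaseChange`).

* §1 `exists_leviElem` — for `A' A = 1 = A A'` the LEVI ELEMENT `m(A) ∈ H(F_v)` with adapted matrix `diag(A, D)`, `D = T⁻¹ σ(A')ᵀ T`, `D⁻¹ = T⁻¹ σ(A)ᵀ T`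
  (★ ring-level `K2LiuSiegelDoubledLeviMatrix.cstar_levi` + ★ `ofMat`); for `A = 1 + ẑ u`: `D⁻¹ = 1 + ẑ (T⁻¹ σ(u)ᵀ T)` (`σ` fixes `ẑ`, ★ `conjLocal_toLocalRing`).
* §2 `exists_continuousAddEquiv_levi_conj` — for a Siegel `q` the conjugation `t ↦ A t D⁻¹` IS a bi-continuous additive automorphism of `S = Skew`
  (★ p01 recipe: `exists_homeomorph_skew` ∘ `exists_homeomorph_conj`); this is the `L` of ★ F4a and of ★ `addEquivAddHaarChar_skew_conj`.
* §3 **`exists_ball_levi_supply`** — THE SUPPLY, BY CONTINUITY (no level bookkeeping; valid at dyadic and ramified `v`): for `u ∈ M_n(R)`, an OPEN subgroup `U`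
  and characters `χ_w` whose kernels are neighbourhoods of `1`: `∃ j₀, ∀ z ∈ 𝔭_v^{j₀}, ∃ q ∈ U` Levi with `blkA = 1 + ẑ u`, `blkD⁻¹ = 1 + ẑ u′`,
  `χ_v(det_Δ(w_Δ q w_Δ)) = 1` and `|det_Δ(w_Δ q w_Δ)|_v = 1` — `det(1 + ẑu)` is a unit near `z = 0` (`Rˣ` open in the complete normed ring `R`), the matrix of
  `m(1 + ẑu)` and of its inverse are continuous at `z = 0` (Mathlib `continuousAt_matrix_inv`, `NormedRing.inverse_continuousAt`), `det_Δ(w_Δ m w_Δ)_w = (det D)_w → 1`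
  (★ `detDelta_weylDelta_conj`), and the unit sphere of `E_w` is open (ultrametric).

## References
* [Casselman1980] W. Casselman, *The unramified principal series of p-adic groups I*, Compositio Math. 40 (1980), §3 (smooth vectors are fixed by a
  compact open subgroup; its Levi part acts on `N`).
* [HarrisKudlaSweet1996] M. Harris, S. Kudla, W. J. Sweet, J. AMS 9 (1996): §1 (1.11)–(1.12) (`M_Δ ≅ GL_n(E_v)`, `m(a) = diag(a, ᵗā⁻¹)`, `Ad(m(a))` on `N_Δ ≅ Herm_n`).
* [BushnellHenniart2006] C. J. Bushnell, G. Henniart, *The local Langlands conjecture for GL(2)*, §1.1–1.7 (no small subgroups; characters are trivial near `1`).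
-/

set_option autoImplicit false
-- the mandated namespace repeats the single-problem summit's segment (`HodgeConjecture.HodgeConjecture`)
set_option linter.dupNamespace false

noncomputable section

open scoped NNReal Topology
open NumberField IsDedekindDomain Matrix Filter Set
open Literature.NumberTheory.Automorphic Literature.NumberTheory.Automorphic.UnitaryGroup
open Literature.NumberTheory.GelbartRogawski1991.AdaptedBlocks
open Literature.NumberTheory.GelbartRogawski1991.UnitaryDualPair.LocalSplitting
open Literature.NumberTheory.K2Lit.LocalSiegelDoubled
open Summit.HodgeConjecture.HodgeConjecture.Cruxes.HLiu418.K2LiuSiegelLeviWeylAlgebra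
open Summit.HodgeConjecture.HodgeConjecture.Cruxes.HLiu418.K2LiuUnipDeltaLocalCoordinates
open Summit.HodgeConjecture.HodgeConjecture.Cruxes.HLiu418.K2LiuLocalIntertwiningProperty
open Summit.HodgeConjecture.HodgeConjecture.Cruxes.HLiu418.K2LiuUnipDeltaConjugationModulus
open Summit.HodgeConjecture.HodgeConjecture.Cruxes.HLiu418.K2LiuSiegelDoubledLeviMatrix

namespace Summit.HodgeConjecture.HodgeConjecture.Cruxes.HLiu418.K2LiuLocalLeviSupply

variable (F : Type) [Field F] [NumberField F] (E : Type) [Field E] [NumberField E] [Algebra F E]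
  [Algebra.IsQuadraticExtension F E] (c : E ≃ₐ[F] E)
  {δ : E} (hcδ : c δ = -δ) (hδ : δ ≠ 0) {dd : F} (hd : δ * δ = algebraMap F E dd)
  (v : HeightOneSpectrum (𝓞 F)) (n : ℕ) {T₀ : Matrix (Fin n) (Fin n) F} (hT₀ : T₀.IsSymm) (hT₀d : IsUnit T₀.det)
  {JD : Matrix (Fin (n + n)) (Fin (n + n)) E} (hJD : JD = (gramD F n T₀).map (algebraMap F E))

/-! ## §1 The Levi element `m(A)` -/

include hcδ hδ hd hT₀ hT₀d hJD in
/-- **The Levi element `m(A) ∈ H(F_v)`**: for `A' A = 1 = A A'` there is `q ∈ P_Δ(F_v)` with adapted matrix `diag(A, D)`, `D = T⁻¹ σ(A')ᵀ T`, `D⁻¹ = T⁻¹ σ(A)ᵀ T`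
(★ `cstar_levi`: `m(A) = R·diag(A, D)·R⁻¹` is unitary for `T ⊕ −T`). [cite: HarrisKudlaSweet1996, §1 (1.11)] -/
theorem exists_leviElem {A A' : Matrix (Fin n) (Fin n) (LocalRing E v)} (hA'A : A' * A = 1) (hAA' : A * A' = 1) :
    ∃ q : UnitaryGroup.localPi E c (n + n) JD v,
      blkC (matA F E c v n q) = 0 ∧ blkB (matA F E c v n q) = 0 ∧ blkA (matA F E c v n q) = A ∧
        blkD (matA F E c v n q) = (gramS F E v n T₀)⁻¹ * (A'.map (conjLocal E c v))ᵀ * gramS F E v n T₀ ∧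
        (blkD (matA F E c v n q))⁻¹ = (gramS F E v n T₀)⁻¹ * (A.map (conjLocal E c v))ᵀ * gramS F E v n T₀ ∧
        matA F E c v n q = cayR (LocalRing E v) (Fin n) *
          Matrix.fromBlocks A 0 0 ((gramS F E v n T₀)⁻¹ * (A'.map (conjLocal E c v))ᵀ * gramS F E v n T₀) * cayRinv (LocalRing E v) (Fin n) := by
  have hT : IsUnit (gramS F E v n T₀).det := isUnit_det_gramS' F E v n hT₀d
  have hTσ : (gramS F E v n T₀).map (conjLocal E c v) = gramS F E v n T₀ := gramS_map_conj F E c v n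
  have hTt : (gramS F E v n T₀)ᵀ = gramS F E v n T₀ := gramS_transpose F E v n hT₀
  have hσ : ∀ x, conjLocal E c v (conjLocal E c v x) = x := conjLocal_conjLocal' F E c hcδ hδ hd v
  set D : Matrix (Fin n) (Fin n) (LocalRing E v) := (gramS F E v n T₀)⁻¹ * (A'.map (conjLocal E c v))ᵀ * gramS F E v n T₀ with hD
  set D' : Matrix (Fin n) (Fin n) (LocalRing E v) := (gramS F E v n T₀)⁻¹ * (A.map (conjLocal E c v))ᵀ * gramS F E v n T₀ with hD'
  have hDD' : D * D' = 1 := by rw [hD, hD', leviD_mul hT, hAA', leviD_one hT]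
  have hD'D : D' * D = 1 := by rw [hD, hD', leviD_mul hT, hA'A, leviD_one hT]
  set M : Matrix (Fin n ⊕ Fin n) (Fin n ⊕ Fin n) (LocalRing E v) :=
    cayR (LocalRing E v) (Fin n) * Matrix.fromBlocks A 0 0 D * cayRinv (LocalRing E v) (Fin n) with hM
  have hMdet : IsUnit M.det := by
    rw [hM, Matrix.det_mul, Matrix.det_mul, mul_comm (cayR _ _).det, mul_assoc, ← Matrix.det_mul, cayR_mul_cayRinv, Matrix.det_one, mul_one,
      Matrix.det_fromBlocks_zero₂₁]
    exact (Matrix.isUnit_det_of_right_inverse hAA').mul (Matrix.isUnit_det_of_right_inverse hDD')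
  have hMc : (M.map (conjLocal E c v))ᵀ * Matrix.fromBlocks (gramS F E v n T₀) 0 0 (-gramS F E v n T₀) * M =
      Matrix.fromBlocks (gramS F E v n T₀) 0 0 (-gramS F E v n T₀) := by
    rw [hM, hD]
    exact cstar_levi hT hTσ hTt hσ hA'A
  refine ⟨ofMat F E c v n hJD M hMdet hMc, ?_⟩
  have hmatA : matA F E c v n (ofMat F E c v n hJD M hMdet hMc) = M := matA_ofMat F E c v n hJD M hMdet hMc
  have hadapt : adapt (matA F E c v n (ofMat F E c v n hJD M hMdet hMc)) = Matrix.fromBlocks A 0 0 D := by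
    rw [hmatA, hM, adapt_conj]
  rw [adapt_eq] at hadapt
  obtain ⟨hA, hB, hC, hDq⟩ := Matrix.fromBlocks_inj.1 hadapt
  refine ⟨hC, hB, hA, hDq, ?_, hmatA⟩
  rw [hDq]
  exact Matrix.inv_eq_right_inv hDD'

omit [Algebra.IsQuadraticExtension F E] in
include hT₀d in
/-- for `A = 1 + ẑ u` (`ẑ = toLocalRing z`, `σ`-fixed): `T⁻¹ σ(A)ᵀ T = 1 + ẑ (T⁻¹ σ(u)ᵀ T)`. [cite: HarrisKudlaSweet1996, §1 (1.12)] -/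
theorem leviD_inv_one_add_smul (z : v.adicCompletion F) (u : Matrix (Fin n) (Fin n) (LocalRing E v)) :
    (gramS F E v n T₀)⁻¹ * ((1 + toLocalRing E v z • u).map (conjLocal E c v))ᵀ * gramS F E v n T₀ =
      1 + toLocalRing E v z • ((gramS F E v n T₀)⁻¹ * (u.map (conjLocal E c v))ᵀ * gramS F E v n T₀) := by
  have hT : IsUnit (gramS F E v n T₀).det := isUnit_det_gramS' F E v n hT₀d
  have hmap : (1 + toLocalRing E v z • u).map (conjLocal E c v) = 1 + toLocalRing E v z • u.map (conjLocal E c v) := by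
    rw [Matrix.map_add _ (map_add _), Matrix.map_one _ (map_zero _) (map_one _)]
    congr 1
    ext i j
    simp only [Matrix.map_apply, Matrix.smul_apply, smul_eq_mul, map_mul, conjLocal_toLocalRing]
  rw [hmap, Matrix.transpose_add, Matrix.transpose_one, Matrix.transpose_smul, Matrix.mul_add, Matrix.add_mul, Matrix.mul_one,
    Matrix.nonsing_inv_mul _ hT, Matrix.mul_smul, Matrix.smul_mul]

/-! ## §2 The conjugation `t ↦ A t D⁻¹` as a bi-continuous automorphism of `Skew` -/

include hcδ hδ hd hT₀ hJD in
/-- **`Ad(q)` on `Skew` is a bi-continuous additive automorphism**: for `q ∈ P_Δ(F_v)` there is `L : S ≃ₜ+ S` with `(L t) = A t D⁻¹`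
(`A = blkA`, `D = blkD`; transport of `u ↦ q u q⁻¹` along ★ `exists_homeomorph_skew`). [cite: HarrisKudlaSweet1996, §1 (1.12)] -/
theorem exists_continuousAddEquiv_levi_conj (S : AddSubgroup (Matrix (Fin n) (Fin n) (LocalRing E v)))
    (hS : ∀ t, t ∈ S ↔ (t.map (conjLocal E c v))ᵀ * gramS F E v n T₀ + gramS F E v n T₀ * t = 0)
    {q : UnitaryGroup.localPi E c (n + n) JD v} (hq : IsSiegelDelta F E c hcδ hδ hd v n hT₀ hJD q) :
    ∃ L : S ≃ₜ+ S, ∀ t : S, (L t).1 = blkA (matA F E c v n q) * t.1 * (blkD (matA F E c v n q))⁻¹ := by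
  have hC := (isSiegelDelta_iff_blkC_eq_zero F E c hcδ hδ hd v n hT₀ hJD q).1 hq
  obtain ⟨ψ, hψ, hψmul⟩ := exists_homeomorph_skew F E c v n hJD S hS
  obtain ⟨e, he⟩ := exists_homeomorph_conj F E c hcδ hδ hd v n hT₀ hJD hq
  have hemul : ∀ u u', e (u * u') = e u * e u' := fun u u' => Subtype.ext (by
    rw [he, he, he]
    show q * ((u : UnitaryGroup.localPi E c (n + n) JD v) * (u' : UnitaryGroup.localPi E c (n + n) JD v)) * q⁻¹ =
      q * (u : UnitaryGroup.localPi E c (n + n) JD v) * q⁻¹ * (q * (u' : UnitaryGroup.localPi E c (n + n) JD v) * q⁻¹)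
    group)
  have hψsymm_add : ∀ s s' : S, ψ.symm (s + s') = ψ.symm s * ψ.symm s' := fun s s' =>
    ψ.injective (by rw [ψ.apply_symm_apply, hψmul, ψ.apply_symm_apply, ψ.apply_symm_apply])
  refine ⟨⟨⟨⟨fun t => ψ (e (ψ.symm t)), fun t => ψ (e.symm (ψ.symm t)),
      fun t => by simp only [Homeomorph.symm_apply_apply, Homeomorph.apply_symm_apply],
      fun t => by simp only [Homeomorph.symm_apply_apply, Homeomorph.apply_symm_apply]⟩,
    fun t t' => by
      show ψ (e (ψ.symm (t + t'))) = ψ (e (ψ.symm t)) + ψ (e (ψ.symm t'))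
      rw [hψsymm_add, hemul, hψmul]⟩,
    ψ.continuous.comp (e.continuous.comp ψ.symm.continuous), ψ.continuous.comp (e.symm.continuous.comp ψ.symm.continuous)⟩, fun t => ?_⟩
  have ht1 : blkB (matA F E c v n (ψ.symm t : UnitaryGroup.localPi E c (n + n) JD v)) = t.1 := by
    have h := hψ (ψ.symm t)
    rw [ψ.apply_symm_apply] at h
    exact h.symm
  show (ψ (e (ψ.symm t))).1 = _
  rw [hψ, he]
  show blkB (matA F E c v n (q * (ψ.symm t : UnitaryGroup.localPi E c (n + n) JD v) * q⁻¹)) = _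
  conv_lhs => rw [eq_nElem_of_mem_unipDeltaLocal F E c v n hJD (ψ.symm t).2]
  rw [blkB_matA_conj_nElem F E c v n hJD hC, ht1]

/-! ## §3 The supply of Levi elements `m(1 + ẑu)` in an open subgroup, by continuity -/

omit [Algebra.IsQuadraticExtension F E] in
/-- `R (X ⊕ Y) R⁻¹ · R (X' ⊕ Y') R⁻¹ = R (XX' ⊕ YY') R⁻¹`. [cite: HarrisKudlaSweet1996, §1 (1.11)] -/
theorem cay_diag_mul_cay_diag (X Y X' Y' : Matrix (Fin n) (Fin n) (LocalRing E v)) :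
    cayR (LocalRing E v) (Fin n) * Matrix.fromBlocks X 0 0 Y * cayRinv (LocalRing E v) (Fin n) *
        (cayR (LocalRing E v) (Fin n) * Matrix.fromBlocks X' 0 0 Y' * cayRinv (LocalRing E v) (Fin n)) =
      cayR (LocalRing E v) (Fin n) * Matrix.fromBlocks (X * X') 0 0 (Y * Y') * cayRinv (LocalRing E v) (Fin n) := by
  have h1 : Matrix.fromBlocks X 0 0 Y * Matrix.fromBlocks X' 0 0 Y' = Matrix.fromBlocks (X * X') 0 0 (Y * Y') := by
    rw [Matrix.fromBlocks_multiply]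
    simp only [Matrix.mul_zero, Matrix.zero_mul, add_zero, zero_add]
  calc cayR (LocalRing E v) (Fin n) * Matrix.fromBlocks X 0 0 Y * cayRinv (LocalRing E v) (Fin n) *
        (cayR (LocalRing E v) (Fin n) * Matrix.fromBlocks X' 0 0 Y' * cayRinv (LocalRing E v) (Fin n))
      = cayR (LocalRing E v) (Fin n) * (Matrix.fromBlocks X 0 0 Y * (cayRinv (LocalRing E v) (Fin n) * cayR (LocalRing E v) (Fin n)) *
          Matrix.fromBlocks X' 0 0 Y') * cayRinv (LocalRing E v) (Fin n) := by simp only [Matrix.mul_assoc]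
    _ = cayR (LocalRing E v) (Fin n) * Matrix.fromBlocks (X * X') 0 0 (Y * Y') * cayRinv (LocalRing E v) (Fin n) := by
        rw [cayRinv_mul_cayR, Matrix.mul_one, h1]

omit [Algebra.IsQuadraticExtension F E] in
/-- `z ↦ (1 + ẑu)⁻¹` is continuous at `z = 0` (with value `1`): `E ⊗ F_v` is a complete normed ring, so `Ring.inverse` is continuous at `det 1 = 1`
(Mathlib `continuousAt_matrix_inv`). [cite: BushnellHenniart2006, §1.1] -/
theorem continuousAt_inv_one_add_smul (u : Matrix (Fin n) (Fin n) (LocalRing E v)) :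
    ContinuousAt (fun z : v.adicCompletion F => (1 + toLocalRing E v z • u)⁻¹) 0 := by
  have hAc : Continuous fun z : v.adicCompletion F => (1 : Matrix (Fin n) (Fin n) (LocalRing E v)) + toLocalRing E v z • u :=
    continuous_const.add ((continuous_toLocalRing E v).smul continuous_const)
  have hA0 : (1 : Matrix (Fin n) (Fin n) (LocalRing E v)) + toLocalRing E v 0 • u = 1 := by rw [map_zero, zero_smul, add_zero]
  have h1 : ContinuousAt Ring.inverse ((1 : Matrix (Fin n) (Fin n) (LocalRing E v)) + toLocalRing E v 0 • u).det := by
    rw [hA0, Matrix.det_one]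
    exact NormedRing.inverse_continuousAt (1 : (LocalRing E v)ˣ)
  exact ContinuousAt.comp (f := fun z : v.adicCompletion F => (1 : Matrix (Fin n) (Fin n) (LocalRing E v)) + toLocalRing E v z • u)
    (g := Inv.inv) (continuousAt_matrix_inv _ h1) hAc.continuousAt

omit [Algebra.IsQuadraticExtension F E] in
/-- **topological membership**: if `U ≤ H(F_v)` is open and `M, M′ : F_v → M_{2n}(E ⊗ F_v)` are continuous at `0` with `M 0 = 1 = M′ 0`, then for `z` near `0` every
`q ∈ H(F_v)` whose matrix is `M z` and whose inverse has matrix `M′ z` lies in `U` (the topology of `H(F_v)` is induced from `M × Mᵐᵒᵖ` along ★ `localPiEquiv`,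
the inclusion `U(J)(F_v) ≤ GL`, and `Units.embedProduct`). [cite: Casselman1980, §3] -/
theorem eventually_mem_of_matS_eq {U : Subgroup (UnitaryGroup.localPi E c (n + n) JD v)}
    (hU : IsOpen (U : Set (UnitaryGroup.localPi E c (n + n) JD v)))
    {M M' : v.adicCompletion F → Matrix (Fin (n + n)) (Fin (n + n)) (LocalRing E v)} (hM : ContinuousAt M 0) (hM' : ContinuousAt M' 0)
    (hM0 : M 0 = 1) (hM'0 : M' 0 = 1) :
    ∀ᶠ z in 𝓝 (0 : v.adicCompletion F), ∀ q : UnitaryGroup.localPi E c (n + n) JD v,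
      matS F E c v n q = M z → matS F E c v n q⁻¹ = M' z → q ∈ U := by
  have hU' : IsOpen ((localPiEquiv E c (n + n) JD v) '' (U : Set (UnitaryGroup.localPi E c (n + n) JD v))) :=
    (localPiEquiv E c (n + n) JD v).toHomeomorph.isOpenMap _ hU
  obtain ⟨O₁, hO₁, hO₁eq⟩ := isOpen_induced_iff.1 hU'
  obtain ⟨O, hO, hOeq⟩ := isOpen_induced_iff.1 hO₁
  have hΦc : ContinuousAt (fun z => (M z, MulOpposite.op (M' z))) 0 := hM.prodMk (MulOpposite.continuous_op.continuousAt.comp hM')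
  have h1O : ((1 : Matrix (Fin (n + n)) (Fin (n + n)) (LocalRing E v)), MulOpposite.op (1 : Matrix (Fin (n + n)) (Fin (n + n)) (LocalRing E v))) ∈ O := by
    have h1U' : (localPiEquiv E c (n + n) JD v) 1 ∈ (localPiEquiv E c (n + n) JD v) '' (U : Set _) := ⟨1, U.one_mem, rfl⟩
    rw [← hO₁eq, Set.mem_preimage, map_one, OneMemClass.coe_one, ← hOeq, Set.mem_preimage, map_one] at h1U'
    exact h1U'
  have hW : ∀ᶠ z in 𝓝 (0 : v.adicCompletion F), (M z, MulOpposite.op (M' z)) ∈ O :=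
    hΦc.preimage_mem_nhds (by rw [hM0, hM'0]; exact hO.mem_nhds h1O)
  filter_upwards [hW] with z hz q hq hq'
  have hemb : Units.embedProduct _ ((localPiEquiv E c (n + n) JD v q).1) = (M z, MulOpposite.op (M' z)) := by
    rw [Units.embedProduct_apply]
    refine Prod.ext hq ?_
    show MulOpposite.op (Units.val ((localPiEquiv E c (n + n) JD v q).1⁻¹)) = MulOpposite.op (M' z)
    rw [← Subgroup.coe_inv, ← map_inv]
    exact congrArg MulOpposite.op hq'
  have hq1 : (localPiEquiv E c (n + n) JD v q).1 ∈ O₁ := by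
    rw [← hOeq, Set.mem_preimage, hemb]; exact hz
  have hq2 : localPiEquiv E c (n + n) JD v q ∈ (localPiEquiv E c (n + n) JD v) '' (U : Set _) := by
    rw [← hO₁eq]; exact hq1
  obtain ⟨q', hq'U, hq'e⟩ := hq2
  rwa [← (localPiEquiv E c (n + n) JD v).injective hq'e]

omit [NumberField F] [Algebra F E] in
/-- in the ultrametric field `E_w` the unit sphere is a neighbourhood of `1`: a function continuous at `0` with value `1` has norm `1` near `0`.
[cite: BushnellHenniart2006, §1.1] -/
theorem eventually_norm_eq_one {X : Type*} [TopologicalSpace X] {x₀ : X} (w : HeightOneSpectrum (𝓞 E)) {f : X → w.adicCompletion E}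
    (hf : ContinuousAt f x₀) (hf0 : f x₀ = 1) : ∀ᶠ x in 𝓝 x₀, ‖f x‖ = 1 := by
  have hball : Metric.ball (1 : w.adicCompletion E) 1 ∈ 𝓝 (f x₀) := by rw [hf0]; exact Metric.ball_mem_nhds _ one_pos
  filter_upwards [hf.preimage_mem_nhds hball] with x hx
  have hlt : ‖f x - 1‖ < ‖(1 : w.adicCompletion E)‖ := by rw [norm_one, ← dist_eq_norm]; exact hx
  have h := IsUltrametricDist.norm_add_eq_max_of_norm_ne_norm (ne_of_lt hlt)
  rw [sub_add_cancel] at h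
  rw [h, max_eq_right hlt.le, norm_one]

include hcδ hδ hd hT₀ hT₀d hJD in
/-- **SUPPLY OF LEVI ELEMENTS IN AN OPEN SUBGROUP.**  Let `u ∈ M_n(E ⊗ F_v)`, `U` an OPEN subgroup of `H(F_v)` (e.g. the smoothness group of a `K_v`-finite
section) and `χ_w : E_wˣ →* ℂˣ` characters whose kernels are neighbourhoods of `1` (every continuous character; in particular the local components of a Hecke
character).  Then for all `z ∈ F_v` in a small ball `𝔭_v^{j₀}` there is a LEVI element `q ∈ U` with adapted blocks `diag(1 + ẑu, D)`, `D⁻¹ = 1 + ẑ·(T⁻¹σ(u)ᵀT)`, and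
`χ_v(det_Δ(w_Δ q w_Δ)) = 1 = |det_Δ(w_Δ q w_Δ)|_v` — exactly the data (`hqU hqC hqB hqχ hqabs`, with `hL` from `exists_continuousAddEquiv_levi_conj`) of ★ F4a
`K2LiuBadPlaceWhittakerShells.setIntegral_shell_eq_zero_of_levi`.  Proof by continuity at `z = 0` (no congruence-level bookkeeping, so dyadic and ramified `v` are
covered): `det(1 + ẑu)` is a unit near `0`, the matrices of `m(1 + ẑu)` and `m(1 + ẑu)⁻¹` depend continuously on `z` at `0`, and `det_Δ(w_Δ m w_Δ)_w = (det D)_w → 1`.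
[cite: Casselman1980, §3] [cite: HarrisKudlaSweet1996, §1 (1.11)–(1.12)] [cite: BushnellHenniart2006, §1.1] -/
theorem exists_ball_levi_supply (u : Matrix (Fin n) (Fin n) (LocalRing E v))
    {U : Subgroup (UnitaryGroup.localPi E c (n + n) JD v)} (hU : IsOpen (U : Set (UnitaryGroup.localPi E c (n + n) JD v)))
    (χv : ∀ w : PlacesOver E v, (w.1.adicCompletion E)ˣ →* ℂˣ)
    (hχv : ∀ w : PlacesOver E v, ∃ V ∈ 𝓝 (1 : w.1.adicCompletion E), ∀ x ∈ V, ∀ hx : IsUnit x, χv w hx.unit = 1) :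
    ∃ j₀ : ℤ, ∀ z ∈ primePowBall (v.adicCompletion F) j₀, ∃ q ∈ U,
      blkC (matA F E c v n q) = 0 ∧ blkB (matA F E c v n q) = 0 ∧ blkA (matA F E c v n q) = 1 + toLocalRing E v z • u ∧
        (blkD (matA F E c v n q))⁻¹ = 1 + toLocalRing E v z • ((gramS F E v n T₀)⁻¹ * (u.map (conjLocal E c v))ᵀ * gramS F E v n T₀) ∧
        chiDet F E c v n χv (weylDelta F E c v n hJD * q * weylDelta F E c v n hJD) = 1 ∧
        absDetDelta F E c v n (weylDelta F E c v n hJD * q * weylDelta F E c v n hJD) = 1 := by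
  classical
  have hT : IsUnit (gramS F E v n T₀).det := isUnit_det_gramS' F E v n hT₀d
  -- the matrix-valued functions of `z`: `A z = 1 + ẑu`, `G X = T⁻¹ σ(X)ᵀ T` (so `D z = G (A z)⁻¹`, `D z⁻¹ = G (A z)`), `H X Y = matrix of R (X ⊕ Y) R⁻¹`
  obtain ⟨A, hA⟩ : ∃ A : v.adicCompletion F → Matrix (Fin n) (Fin n) (LocalRing E v), ∀ z, A z = 1 + toLocalRing E v z • u := ⟨_, fun _ => rfl⟩
  obtain ⟨G, hG⟩ : ∃ G : Matrix (Fin n) (Fin n) (LocalRing E v) → Matrix (Fin n) (Fin n) (LocalRing E v),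
      ∀ X, G X = (gramS F E v n T₀)⁻¹ * (X.map (conjLocal E c v))ᵀ * gramS F E v n T₀ := ⟨_, fun _ => rfl⟩
  obtain ⟨H, hH⟩ : ∃ H : Matrix (Fin n) (Fin n) (LocalRing E v) → Matrix (Fin n) (Fin n) (LocalRing E v) → Matrix (Fin (n + n)) (Fin (n + n)) (LocalRing E v),
      ∀ X Y, H X Y = Matrix.reindex (e₂ n) (e₂ n) (cayR (LocalRing E v) (Fin n) * Matrix.fromBlocks X 0 0 Y * cayRinv (LocalRing E v) (Fin n)) :=
    ⟨_, fun _ _ => rfl⟩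
  -- values at `0`
  have hA0 : A 0 = 1 := by rw [hA, map_zero, zero_smul, add_zero]
  have hinv0 : (A 0)⁻¹ = 1 := by rw [hA0, inv_one]
  have hG1 : G 1 = 1 := by rw [hG]; exact leviD_one hT
  have hGG : ∀ z, IsUnit (A z).det → G ((A z)⁻¹) * G (A z) = 1 := fun z hz => by
    rw [hG, hG, leviD_mul hT, Matrix.mul_nonsing_inv _ hz, leviD_one hT]
  have hH11 : H 1 1 = 1 := by
    rw [hH, Matrix.fromBlocks_one, Matrix.mul_one, cayR_mul_cayRinv, Matrix.reindex_apply, Matrix.submatrix_one_equiv]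
  -- continuity
  have hAc : Continuous A := by
    have hfun : A = fun z => 1 + toLocalRing E v z • u := funext hA
    rw [hfun]
    exact continuous_const.add ((continuous_toLocalRing E v).smul continuous_const)
  have hGc : Continuous G := by
    have hfun : G = fun X => (gramS F E v n T₀)⁻¹ * (X.map (conjLocal E c v))ᵀ * gramS F E v n T₀ := funext hG
    rw [hfun]
    exact (continuous_const.matrix_mul (continuous_id.matrix_map (continuous_conjLocal E c v)).matrix_transpose).matrix_mul continuous_const
  have hHc : Continuous fun p : Matrix (Fin n) (Fin n) (LocalRing E v) × Matrix (Fin n) (Fin n) (LocalRing E v) => H p.1 p.2 := by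
    have hfun : (fun p : Matrix (Fin n) (Fin n) (LocalRing E v) × Matrix (Fin n) (Fin n) (LocalRing E v) => H p.1 p.2) =
        fun p => Matrix.reindex (e₂ n) (e₂ n) (cayR (LocalRing E v) (Fin n) * Matrix.fromBlocks p.1 0 0 p.2 * cayRinv (LocalRing E v) (Fin n)) :=
      funext fun p => hH p.1 p.2
    rw [hfun]
    exact ((continuous_const.matrix_mul (Continuous.matrix_fromBlocks continuous_fst continuous_const continuous_const continuous_snd)).matrix_mul
      continuous_const).matrix_reindex _ _
  have hinv : ContinuousAt (fun z => (A z)⁻¹) 0 := by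
    have h := continuousAt_inv_one_add_smul F E v n u
    refine (continuousAt_congr (Eventually.of_forall fun z => ?_)).2 h
    rw [hA]
  have hDc : ContinuousAt (fun z => G ((A z)⁻¹)) 0 := hGc.continuousAt.comp hinv
  have hD0 : G ((A 0)⁻¹) = 1 := by rw [hinv0, hG1]
  have hdetDc : ∀ w : PlacesOver E v, ContinuousAt (fun z => (G ((A z)⁻¹)).det w) 0 := fun w =>
    ((continuous_apply w).comp (continuous_id.matrix_det)).continuousAt.comp hDc
  have hdetD0 : ∀ w : PlacesOver E v, (G ((A 0)⁻¹)).det w = 1 := fun w => by rw [hD0, Matrix.det_one, Pi.one_apply]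
  -- (a) `det (A z)` is a unit near `0`
  have hW₁ : ∀ᶠ z in 𝓝 (0 : v.adicCompletion F), IsUnit (A z).det := by
    have hopen : IsOpen {x : LocalRing E v | IsUnit x} := Units.isOpen
    exact (hAc.matrix_det).continuousAt.preimage_mem_nhds (hopen.mem_nhds (show IsUnit (A 0).det by rw [hA0, Matrix.det_one]; exact isUnit_one))
  -- (b) membership in `U` near `0`
  have hW₂ := eventually_mem_of_matS_eq F E c v n hU (M := fun z => H (A z) (G ((A z)⁻¹))) (M' := fun z => H ((A z)⁻¹) (G (A z)))
    (hHc.continuousAt.comp (hAc.continuousAt.prodMk hDc)) (hHc.continuousAt.comp (hinv.prodMk (hGc.continuousAt.comp hAc.continuousAt)))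
    (by rw [hD0, hA0, hH11]) (by rw [hinv0, hA0, hG1, hH11])
  -- (c) the characters and (d) the norms are `1` near `0`
  have hW₃ : ∀ᶠ z in 𝓝 (0 : v.adicCompletion F), ∀ w : PlacesOver E v, ∀ hx : IsUnit ((G ((A z)⁻¹)).det w), χv w hx.unit = 1 := by
    refine eventually_all.2 fun w => ?_
    obtain ⟨V, hV, hVχ⟩ := hχv w
    have h := (hdetDc w).preimage_mem_nhds (show V ∈ 𝓝 ((G ((A 0)⁻¹)).det w) by rw [hdetD0]; exact hV)
    filter_upwards [h] with z hz hx
    exact hVχ _ hz hx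
  have hW₄ : ∀ᶠ z in 𝓝 (0 : v.adicCompletion F), ∀ w : PlacesOver E v, ‖(G ((A z)⁻¹)).det w‖ = 1 :=
    eventually_all.2 fun w => eventually_norm_eq_one E w.1 (hdetDc w) (hdetD0 w)
  -- collect into one ball
  obtain ⟨j₀, hj₀⟩ := exists_primePowBall_subset_of_mem_nhds_zero ((hW₁.and hW₂).and (hW₃.and hW₄))
  refine ⟨j₀, fun z hz => ?_⟩
  obtain ⟨⟨hzu, hzU⟩, hzχ, hzabs⟩ := hj₀ hz
  -- the Levi element at `z`
  have hA'A : (A z)⁻¹ * A z = 1 := Matrix.nonsing_inv_mul _ hzu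
  have hAA' : A z * (A z)⁻¹ = 1 := Matrix.mul_nonsing_inv _ hzu
  obtain ⟨q, hC, hB, hAq, hDq, hDinv, hmatA⟩ := exists_leviElem F E c hcδ hδ hd v n hT₀ hT₀d hJD hA'A hAA'
  have hDq' : blkD (matA F E c v n q) = G ((A z)⁻¹) := by rw [hDq, hG]
  have hmatS : matS F E c v n q = H (A z) (G ((A z)⁻¹)) := by rw [← reindex_matA, hmatA, hH, hG]
  have hMM' : H (A z) (G ((A z)⁻¹)) * H ((A z)⁻¹) (G (A z)) = 1 := by
    rw [hH, hH, Matrix.reindex_apply, Matrix.reindex_apply, Matrix.submatrix_mul_equiv, cay_diag_mul_cay_diag, hAA', hGG z hzu,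
      Matrix.fromBlocks_one, Matrix.mul_one, cayR_mul_cayRinv, Matrix.submatrix_one_equiv]
  have hmatSinv : matS F E c v n q⁻¹ = H ((A z)⁻¹) (G (A z)) := by
    have h1 : matS F E c v n q⁻¹ * matS F E c v n q = 1 := by rw [← matS_mul, inv_mul_cancel, matS_one]
    rw [hmatS] at h1
    calc matS F E c v n q⁻¹ = matS F E c v n q⁻¹ * (H (A z) (G ((A z)⁻¹)) * H ((A z)⁻¹) (G (A z))) := by rw [hMM', Matrix.mul_one]
      _ = H ((A z)⁻¹) (G (A z)) := by rw [← Matrix.mul_assoc, h1, Matrix.one_mul]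
  refine ⟨q, hzU q hmatS hmatSinv, hC, hB, by rw [hAq, hA], ?_, ?_, ?_⟩
  · rw [hDinv, hA]
    exact leviD_inv_one_add_smul F E c v n hT₀d z u
  · -- `χ_v(det_Δ(w_Δ q w_Δ)) = 1`
    unfold chiDet
    refine Finset.prod_eq_one fun w _ => ?_
    rw [detDelta_weylDelta_conj F E c v n hJD hC hB w, hDq']
    by_cases hx : IsUnit ((G ((A z)⁻¹)).det w)
    · rw [dif_pos hx]; exact hzχ w hx
    · rw [dif_neg hx]
  · -- `|det_Δ(w_Δ q w_Δ)|_v = 1`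
    unfold absDetDelta
    refine Finset.prod_eq_one fun w _ => ?_
    rw [detDelta_weylDelta_conj F E c v n hJD hC hB w, hDq']
    exact hzabs w

end Summit.HodgeConjecture.HodgeConjecture.Cruxes.HLiu418.K2LiuLocalLeviSupply

end
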